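import Summits.NavierStokesRegularity.NavierStokesRegularity.Theses.AxisymmetricExtremality
import Summits.NavierStokesRegularity.NavierStokesRegularity.Theorems.AxisymmetricExtremalityAxisymmetricKatoGlobalStubSeregin2020TypeIILemma22EnergyInequality
import Summits.NavierStokesRegularity.NavierStokesRegularity.Theorems.AxisymmetricExtremalityAxisymmetricKatoGlobalStubSeregin2020TypeIILemma22AcrossAxisTools
import HarnessLib

/-!
# Seregin 2020, Lemma 2.2 (after Nazarov–Uraltseva 2012): the slice integrands of the energy
# inequality as space–time integrable functions, off the axis and across the regular axis

Helper toward the stub `stub_seregin2020TypeII` of the crux `AxisymmetricKatoGlobal` (= the named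
fact `Literature.Analysis.FluidPDE.Seregin2020_axisymmetricSingularPoint_typeII`, G. Seregin,
Anal. Math. Phys. 10 (2020) Paper 46 = arXiv:2006.04140, Thm 2.1; remaining ingredient:
Lemma 2.2). The energy inequality `supersolution_energy_ineq_offAxis` (sibling
`…Lemma22EnergyInequality`) bounds `η(t)M(t) - η(t₁)M(t₁)` by the time integral of the slice
functionals `-(G_H + T₁) + T_U + T_b` and `η'M`. To pass it through the regular part of the axis
(sibling `…Lemma22AcrossAxis`) the five slice integrands are handled as functions on
`(t₁, t] × ℝ³`:

* `intervalIntegral_sliceFunctionals_eq_integral_prod` — Fubini for the five slice functionals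
  (`∫_{t₁}^t (η(-(G_H+T₁)+T_U+T_b) + η'M) ds` as ONE space–time integral for `vol|(t₁,t] ⊗ vol`);
* `integrable_sliceIntegrands_offAxis` — for cut-offs supported off the axis all five integrands
  are continuous with compact support inside the region of continuity, hence integrable for
  `vol|(t₁,t] ⊗ vol`;
* `integrable_sliceIntegrands_acrossAxis` — for cut-offs `Θ ∈ C¹_c(O)` with `O` meeting the axis,
  `Φ`, `∇Φ` continuous on the whole slab, and a drift `U ∈ L³` continuous off the axis: the
  three continuous integrands, the drift term `H(Φ)⟪U, ∇Θ²⟫` (`|U| ≤ 1 + |U|³`) and the axis-drift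
  term `(2/ϱ)H(Φ)∂_ϱΘ²` (`1/ϱ ∈ L¹_loc(ℝ³)`) are integrable for `vol|(t₁,t] ⊗ vol`;
* `supersolution_energy_ineq_offAxis_prod` — the energy inequality off the axis with its
  right-hand side written as ONE space–time integral (Fubini);
* `tendsto_integral_mul_of_eventually_eq_one` — dominated convergence for bulk terms multiplied
  by cut-offs with values in `[0,1]` tending to `1` a.e.

## References

* G. Seregin, Anal. Math. Phys. 10 (2020), Paper 46 = arXiv:2006.04140, Lemma 2.2 (arXiv p. 8).
  [Seregin2020]
* A. I. Nazarov, N. N. Uraltseva, St. Petersburg Math. J. 23 (2012) 93–115 = arXiv:1011.1888,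
  §3 (3.2), (3.9), Remark 9; §4 Lemma 4.2. [NazarovUraltseva2012]
-/

-- the problem directory repeats the summit name (D-0017); core's `dupNamespace` linter fires
set_option linter.dupNamespace false

noncomputable section

open MeasureTheory Set Function Filter Topology TopologicalSpace Metric WithLp intervalIntegral
open scoped NNReal ENNReal InnerProductSpace RealInnerProductSpace Laplacian

namespace Summit.NavierStokesRegularity.NavierStokesRegularity.Theorems.AxisymmetricKatoGlobal.EulerScaling

open Literature.Analysis.FluidPDE Literature.Analysis.FluidPDE.Seregin2020

/-! ### Fubini for the slice functionals -/

/-- **The time integral of the slice functionals as one space–time integral.** If the five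
slice integrands `g₁, …, g₅` are integrable for `vol|(t₁,t] ⊗ vol` and `η ∈ C¹`, then the
combined space–time integrand `η(-(g₁+g₂)+g₃+g₄) + η'g₅` is integrable and
`∫_{t₁}^t (η(s)(-(∫g₁(s,·) + ∫g₂(s,·)) + ∫g₃(s,·) + ∫g₄(s,·)) + η'(s)∫g₅(s,·)) ds` equals its
space–time integral (Fubini; the slices are integrable for a.e. `s`). [folklore] -/
theorem intervalIntegral_sliceFunctionals_eq_integral_prod
    {g₁ g₂ g₃ g₄ g₅ : ℝ × EuclideanSpace ℝ (Fin 3) → ℝ} {η : ℝ → ℝ} (hη : ContDiff ℝ 1 η)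
    {t₁ t : ℝ} (h1t : t₁ ≤ t)
    (i₁ : Integrable g₁ ((volume.restrict (Ioc t₁ t)).prod volume))
    (i₂ : Integrable g₂ ((volume.restrict (Ioc t₁ t)).prod volume))
    (i₃ : Integrable g₃ ((volume.restrict (Ioc t₁ t)).prod volume))
    (i₄ : Integrable g₄ ((volume.restrict (Ioc t₁ t)).prod volume))
    (i₅ : Integrable g₅ ((volume.restrict (Ioc t₁ t)).prod volume)) :
    Integrable (fun z => η z.1 * (-(g₁ z + g₂ z) + g₃ z + g₄ z) + deriv η z.1 * g₅ z)
        ((volume.restrict (Ioc t₁ t)).prod volume) ∧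
      ∫ s in t₁..t, (η s * (-((∫ x, g₁ (s, x)) + ∫ x, g₂ (s, x)) + (∫ x, g₃ (s, x)) + ∫ x, g₄ (s, x)) +
          deriv η s * ∫ x, g₅ (s, x)) =
        ∫ z, (η z.1 * (-(g₁ z + g₂ z) + g₃ z + g₄ z) + deriv η z.1 * g₅ z)
          ∂((volume.restrict (Ioc t₁ t)).prod volume) := by
  set μ : Measure (ℝ × EuclideanSpace ℝ (Fin 3)) := (volume.restrict (Ioc t₁ t)).prod volume with hμ
  -- bounds for `η`, `η'` on `[t₁, t]`
  obtain ⟨C, hC⟩ : ∃ C, ∀ s ∈ Icc t₁ t, ‖η s‖ ≤ C ∧ ‖deriv η s‖ ≤ C := by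
    obtain ⟨C₁, hC₁⟩ := isCompact_Icc.exists_bound_of_continuousOn
      (hη.continuous.continuousOn (s := Icc t₁ t))
    obtain ⟨C₂, hC₂⟩ := isCompact_Icc.exists_bound_of_continuousOn
      ((hη.continuous_deriv le_rfl).continuousOn (s := Icc t₁ t))
    exact ⟨max C₁ C₂, fun s hs => ⟨(hC₁ s hs).trans (le_max_left _ _), (hC₂ s hs).trans (le_max_right _ _)⟩⟩
  have hbη : ∀ᵐ z ∂μ, ‖η z.1‖ ≤ C := by
    filter_upwards [ae_fst_mem_Ioc t₁ t] with z hz using (hC z.1 (Ioc_subset_Icc_self hz)).1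
  have hbη' : ∀ᵐ z ∂μ, ‖deriv η z.1‖ ≤ C := by
    filter_upwards [ae_fst_mem_Ioc t₁ t] with z hz using (hC z.1 (Ioc_subset_Icc_self hz)).2
  have mη : AEStronglyMeasurable (fun z : ℝ × EuclideanSpace ℝ (Fin 3) => η z.1) μ :=
    (hη.continuous.comp continuous_fst).aestronglyMeasurable
  have mη' : AEStronglyMeasurable (fun z : ℝ × EuclideanSpace ℝ (Fin 3) => deriv η z.1) μ :=
    ((hη.continuous_deriv le_rfl).comp continuous_fst).aestronglyMeasurable
  have iA : Integrable (fun z => η z.1 * (-(g₁ z + g₂ z) + g₃ z + g₄ z)) μ :=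
    (((i₁.add i₂).neg.add i₃).add i₄).bdd_mul mη hbη
  have iB : Integrable (fun z => deriv η z.1 * g₅ z) μ := i₅.bdd_mul mη' hbη'
  have iF : Integrable (fun z => η z.1 * (-(g₁ z + g₂ z) + g₃ z + g₄ z) + deriv η z.1 * g₅ z) μ := iA.add iB
  refine ⟨iF, ?_⟩
  rw [integral_prod _ iF, intervalIntegral.integral_of_le h1t]
  refine integral_congr_ae ?_
  filter_upwards [i₁.prod_right_ae, i₂.prod_right_ae, i₃.prod_right_ae, i₄.prod_right_ae, i₅.prod_right_ae]
    with s h₁ h₂ h₃ h₄ h₅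
  have i12 : Integrable (fun x => g₁ (s, x) + g₂ (s, x)) volume := h₁.add h₂
  have i12n : Integrable (fun x => -(g₁ (s, x) + g₂ (s, x))) volume := i12.neg
  have i123 : Integrable (fun x => -(g₁ (s, x) + g₂ (s, x)) + g₃ (s, x)) volume := i12n.add h₃
  have i1234 : Integrable (fun x => -(g₁ (s, x) + g₂ (s, x)) + g₃ (s, x) + g₄ (s, x)) volume := i123.add h₄
  have iA' : Integrable (fun x => η s * (-(g₁ (s, x) + g₂ (s, x)) + g₃ (s, x) + g₄ (s, x))) volume :=
    i1234.const_mul _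
  have iB' : Integrable (fun x => deriv η s * g₅ (s, x)) volume := h₅.const_mul _
  rw [integral_add iA' iB', MeasureTheory.integral_const_mul, MeasureTheory.integral_const_mul,
    integral_add i123 h₄, integral_add i12n h₃, MeasureTheory.integral_neg, integral_add h₁ h₂]

/-! ### Dominated convergence for cut-offs tending to one -/

/-- **Removal of a cut-off from a bulk term.** If `F` is integrable and `ψₙ` are a.e.-strongly
measurable with values in `[0,1]` and eventually equal to `1` at a.e. point, then
`∫ ψₙ F → ∫ F` (dominated convergence). [folklore] -/
theorem tendsto_integral_mul_of_eventually_eq_one {α : Type*} [MeasurableSpace α] {μ : Measure α}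
    {F : α → ℝ} (hF : Integrable F μ) {ψ : ℕ → α → ℝ} (hψm : ∀ n, AEStronglyMeasurable (ψ n) μ)
    (hψ01 : ∀ n x, 0 ≤ ψ n x ∧ ψ n x ≤ 1) (hψ1 : ∀ᵐ x ∂μ, ∀ᶠ n in atTop, ψ n x = 1) :
    Tendsto (fun n => ∫ x, ψ n x * F x ∂μ) atTop (𝓝 (∫ x, F x ∂μ)) := by
  refine tendsto_integral_of_dominated_convergence (fun x => ‖F x‖) (fun n => (hψm n).mul hF.aestronglyMeasurable)
    hF.norm (fun n => ae_of_all _ fun x => ?_) ?_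
  · rw [norm_mul, Real.norm_of_nonneg (hψ01 n x).1]
    exact mul_le_of_le_one_left (norm_nonneg _) (hψ01 n x).2
  · filter_upwards [hψ1] with x hx
    refine (tendsto_const_nhds (x := F x)).congr' ?_
    filter_upwards [hx] with n hn
    rw [hn, one_mul]

/-! ### The slice integrands off the axis -/

/-- **The five slice integrands are space–time integrable for cut-offs supported off the axis.**
On a slab `]lo,hi[ × O` (`O` off the axis) with `Φ`, `∇Φ`, `U` jointly continuous,
`H ∈ C²`, `Θ ∈ C¹_c`, `tsupport Θ ⊆ O` and `lo < t₁`, `t < hi`, the integrands of `G_H`, `T₁`,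
`T_U`, `T_b`, `M` are integrable for `vol|(t₁,t] ⊗ vol` (continuous, supported in
`[t₁,t] × tsupport Θ`). [folklore] -/
theorem integrable_sliceIntegrands_offAxis {O : Set (EuclideanSpace ℝ (Fin 3))}
    (hOρ : ∀ x ∈ O, cylRadius x ≠ 0) {lo hi : ℝ}
    {Φ : ℝ → EuclideanSpace ℝ (Fin 3) → ℝ} {U : ℝ → EuclideanSpace ℝ (Fin 3) → EuclideanSpace ℝ (Fin 3)}
    (hΦc : ContinuousOn (uncurry Φ) (Ioo lo hi ×ˢ O))
    (hΦg : ContinuousOn (fun z : ℝ × EuclideanSpace ℝ (Fin 3) => fderiv ℝ (Φ z.1) z.2) (Ioo lo hi ×ˢ O))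
    (hUc : ContinuousOn (uncurry U) (Ioo lo hi ×ˢ O))
    {H : ℝ → ℝ} (hH : ContDiff ℝ 2 H) {Θ : EuclideanSpace ℝ (Fin 3) → ℝ} (hΘ : ContDiff ℝ 1 Θ)
    (hΘc : HasCompactSupport Θ) (hΘO : tsupport Θ ⊆ O) {t₁ t : ℝ} (h1 : lo < t₁) (ht : t < hi) :
    Integrable (fun z : ℝ × EuclideanSpace ℝ (Fin 3) =>
        deriv (deriv H) (Φ z.1 z.2) * ‖gradient (Φ z.1) z.2‖ ^ 2 * Θ z.2 ^ 2)
        ((volume.restrict (Ioc t₁ t)).prod volume) ∧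
      Integrable (fun z : ℝ × EuclideanSpace ℝ (Fin 3) =>
        deriv H (Φ z.1 z.2) * ⟪gradient (Φ z.1) z.2, gradient (fun y => Θ y ^ 2) z.2⟫)
        ((volume.restrict (Ioc t₁ t)).prod volume) ∧
      Integrable (fun z : ℝ × EuclideanSpace ℝ (Fin 3) =>
        H (Φ z.1 z.2) * ⟪U z.1 z.2, gradient (fun y => Θ y ^ 2) z.2⟫)
        ((volume.restrict (Ioc t₁ t)).prod volume) ∧
      Integrable (fun z : ℝ × EuclideanSpace ℝ (Fin 3) =>
        2 / cylRadius z.2 * (H (Φ z.1 z.2) * fderiv ℝ (fun y => Θ y ^ 2) z.2 (eR z.2)))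
        ((volume.restrict (Ioc t₁ t)).prod volume) ∧
      Integrable (fun z : ℝ × EuclideanSpace ℝ (Fin 3) => H (Φ z.1 z.2) * Θ z.2 ^ 2)
        ((volume.restrict (Ioc t₁ t)).prod volume) := by
  set K : Set (EuclideanSpace ℝ (Fin 3)) := tsupport Θ with hKdef
  have hK : IsCompact K := hΘc
  have hΘ0 : ∀ x, x ∉ K → Θ x = 0 := fun x hx => image_eq_zero_of_notMem_tsupport hx
  have hgΘ0 : ∀ x, x ∉ K → gradient (fun y => Θ y ^ 2) x = 0 := fun x hx => gradient_sq_eq_zero_of_notMem hx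
  have hfΘ0 : ∀ x, x ∉ K → fderiv ℝ (fun y => Θ y ^ 2) x = 0 := fun x hx => fderiv_sq_eq_zero_of_notMem hx
  have hH' : ContDiff ℝ 1 (deriv H) := by
    have h2' : ContDiff ℝ (1 + 1) H := by rw [one_add_one_eq_two]; exact hH
    exact h2'.deriv'
  have hΘ2 : ContDiff ℝ 1 fun y => Θ y ^ 2 := hΘ.pow 2
  have hρS : ∀ z ∈ Ioo lo hi ×ˢ O, cylRadius z.2 ≠ 0 := fun z hz => hOρ z.2 hz.2
  -- continuity on the slab of the building blocks
  have cHΦ : ContinuousOn (fun z : ℝ × EuclideanSpace ℝ (Fin 3) => H (Φ z.1 z.2)) (Ioo lo hi ×ˢ O) :=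
    hH.continuous.comp_continuousOn hΦc
  have cH'Φ : ContinuousOn (fun z : ℝ × EuclideanSpace ℝ (Fin 3) => deriv H (Φ z.1 z.2)) (Ioo lo hi ×ˢ O) :=
    hH'.continuous.comp_continuousOn hΦc
  have cH''Φ : ContinuousOn (fun z : ℝ × EuclideanSpace ℝ (Fin 3) => deriv (deriv H) (Φ z.1 z.2)) (Ioo lo hi ×ˢ O) :=
    (hH'.continuous_deriv le_rfl).comp_continuousOn hΦc
  have cgΦ : ContinuousOn (fun z : ℝ × EuclideanSpace ℝ (Fin 3) => gradient (Φ z.1) z.2) (Ioo lo hi ×ˢ O) :=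
    (InnerProductSpace.toDual ℝ (EuclideanSpace ℝ (Fin 3))).symm.continuous.comp_continuousOn hΦg
  have cU : ContinuousOn (fun z : ℝ × EuclideanSpace ℝ (Fin 3) => U z.1 z.2) (Ioo lo hi ×ˢ O) := hUc
  have cΘ2 : Continuous fun z : ℝ × EuclideanSpace ℝ (Fin 3) => Θ z.2 ^ 2 := (hΘ.continuous.comp continuous_snd).pow 2
  have cgΘ2 : Continuous fun z : ℝ × EuclideanSpace ℝ (Fin 3) => gradient (fun y => Θ y ^ 2) z.2 :=
    (continuous_gradient_of_contDiff hΘ2).comp continuous_snd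
  have cfΘ2 : Continuous fun z : ℝ × EuclideanSpace ℝ (Fin 3) => fderiv ℝ (fun y => Θ y ^ 2) z.2 :=
    (hΘ2.continuous_fderiv one_ne_zero).comp continuous_snd
  have ceR : ContinuousOn (fun z : ℝ × EuclideanSpace ℝ (Fin 3) => eR z.2) (Ioo lo hi ×ˢ O) :=
    continuousOn_eR_offAxis.comp continuous_snd.continuousOn fun z hz => hρS z hz
  have cinv : ContinuousOn (fun z : ℝ × EuclideanSpace ℝ (Fin 3) => 2 / cylRadius z.2) (Ioo lo hi ×ˢ O) :=
    continuousOn_const.div (continuous_cylRadius.comp continuous_snd).continuousOn hρS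
  refine ⟨?_, ?_, ?_, ?_, ?_⟩
  · exact integrable_prod_of_continuousOn_of_eq_zero hK hΘO h1 ht ((cH''Φ.mul (cgΦ.norm.pow 2)).mul cΘ2.continuousOn)
      (fun z hz => by simp [hΘ0 z.2 hz])
  · exact integrable_prod_of_continuousOn_of_eq_zero hK hΘO h1 ht (cH'Φ.mul (cgΦ.inner cgΘ2.continuousOn))
      (fun z hz => by
        show deriv H (Φ z.1 z.2) * ⟪gradient (Φ z.1) z.2, gradient (fun y => Θ y ^ 2) z.2⟫ = 0
        rw [hgΘ0 z.2 hz, inner_zero_right, mul_zero])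
  · exact integrable_prod_of_continuousOn_of_eq_zero hK hΘO h1 ht (cHΦ.mul (cU.inner cgΘ2.continuousOn))
      (fun z hz => by
        show H (Φ z.1 z.2) * ⟪U z.1 z.2, gradient (fun y => Θ y ^ 2) z.2⟫ = 0
        rw [hgΘ0 z.2 hz, inner_zero_right, mul_zero])
  · exact integrable_prod_of_continuousOn_of_eq_zero hK hΘO h1 ht (cinv.mul (cHΦ.mul (cfΘ2.continuousOn.clm_apply ceR)))
      (fun z hz => by simp [hfΘ0 z.2 hz])
  · exact integrable_prod_of_continuousOn_of_eq_zero hK hΘO h1 ht (cHΦ.mul cΘ2.continuousOn)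
      (fun z hz => by simp [hΘ0 z.2 hz])

/-- **The energy inequality off the axis, right-hand side as one space–time integral**: in the
setting of `supersolution_energy_ineq_offAxis` (sibling `…Lemma22EnergyInequality`),
`η(t)∫H(Φ(t))Θ² - η(t₁)∫H(Φ(t₁))Θ² ≤ ∬_{(t₁,t]×ℝ³} (η(-(H''(Φ)|∇Φ|²Θ² + H'(Φ)⟪∇Φ,∇Θ²⟫) + H(Φ)⟪U,∇Θ²⟫ + (2/ϱ)H(Φ)∂_ϱΘ²) + η'H(Φ)Θ²)`
(Fubini, `intervalIntegral_sliceFunctionals_eq_integral_prod`).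
[cite: NazarovUraltseva2012, §3 (3.2) and (3.9)] -/
theorem supersolution_energy_ineq_offAxis_prod : ∀ (O : Set (EuclideanSpace ℝ (Fin 3))), IsOpen O →
    (∀ x ∈ O, cylRadius x ≠ 0) → ∀ (lo hi : ℝ)
    (Φ : ℝ → EuclideanSpace ℝ (Fin 3) → ℝ) (U : ℝ → EuclideanSpace ℝ (Fin 3) → EuclideanSpace ℝ (Fin 3)),
    ContinuousOn (uncurry Φ) (Ioo lo hi ×ˢ O) →
    (∀ z ∈ Ioo lo hi ×ˢ O, ContDiffAt ℝ 2 (Φ z.1) z.2) →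
    ContinuousOn (fun z : ℝ × EuclideanSpace ℝ (Fin 3) => fderiv ℝ (Φ z.1) z.2) (Ioo lo hi ×ˢ O) →
    (∀ z ∈ Ioo lo hi ×ˢ O, DifferentiableAt ℝ (fun r => Φ r z.2) z.1) →
    ContinuousOn (fun z : ℝ × EuclideanSpace ℝ (Fin 3) => deriv (fun r => Φ r z.2) z.1) (Ioo lo hi ×ˢ O) →
    ContinuousOn (uncurry U) (Ioo lo hi ×ˢ O) →
    (∀ z ∈ Ioo lo hi ×ˢ O, ContDiffAt ℝ 1 (U z.1) z.2) →
    (∀ z ∈ Ioo lo hi ×ˢ O, VectorCalculus.divergence (U z.1) z.2 = 0) →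
    (∀ z ∈ Ioo lo hi ×ˢ O, 0 ≤ deriv (fun r => Φ r z.2) z.1 + fderiv ℝ (Φ z.1) z.2 (U z.1 z.2) +
      2 / cylRadius z.2 * partialDeriv (eR z.2) (Φ z.1) z.2 - (Laplacian.laplacian (Φ z.1)) z.2) →
    ∀ (H : ℝ → ℝ), ContDiff ℝ 2 H → (∀ v, deriv H v ≤ 0) →
    ∀ (Θ : EuclideanSpace ℝ (Fin 3) → ℝ), ContDiff ℝ 1 Θ → HasCompactSupport Θ → tsupport Θ ⊆ O →
    ∀ (η : ℝ → ℝ), ContDiff ℝ 1 η → (∀ s, 0 ≤ η s) →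
    ∀ (t₁ t : ℝ), lo < t₁ → t₁ ≤ t → t < hi →
    η t * (∫ x, H (Φ t x) * Θ x ^ 2) - η t₁ * (∫ x, H (Φ t₁ x) * Θ x ^ 2) ≤
      ∫ z, (η z.1 * (-(deriv (deriv H) (Φ z.1 z.2) * ‖gradient (Φ z.1) z.2‖ ^ 2 * Θ z.2 ^ 2 +
              deriv H (Φ z.1 z.2) * ⟪gradient (Φ z.1) z.2, gradient (fun y => Θ y ^ 2) z.2⟫) +
            H (Φ z.1 z.2) * ⟪U z.1 z.2, gradient (fun y => Θ y ^ 2) z.2⟫ +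
            2 / cylRadius z.2 * (H (Φ z.1 z.2) * fderiv ℝ (fun y => Θ y ^ 2) z.2 (eR z.2))) +
          deriv η z.1 * (H (Φ z.1 z.2) * Θ z.2 ^ 2)) ∂((volume.restrict (Ioc t₁ t)).prod volume) := by
  intro O hO hOρ lo hi Φ U hΦc hΦs hΦg hΦt hΦt' hUc hUs hdivU hsup H hH hH' Θ hΘ hΘc hΘO η hη hη0
    t₁ t h1 h1t ht
  have hmain := supersolution_energy_ineq_offAxis O hO hOρ lo hi Φ U hΦc hΦs hΦg hΦt hΦt' hUc hUs hdivU hsup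
    H hH hH' Θ hΘ hΘc hΘO η hη hη0 t₁ t h1 h1t ht
    (fun s => ∫ x, H (Φ s x) * Θ x ^ 2)
    (fun s => ∫ x, deriv (deriv H) (Φ s x) * ‖gradient (Φ s) x‖ ^ 2 * Θ x ^ 2)
    (fun s => ∫ x, deriv H (Φ s x) * ⟪gradient (Φ s) x, gradient (fun y => Θ y ^ 2) x⟫)
    (fun s => ∫ x, H (Φ s x) * ⟪U s x, gradient (fun y => Θ y ^ 2) x⟫)
    (fun s => ∫ x, 2 / cylRadius x * (H (Φ s x) * fderiv ℝ (fun y => Θ y ^ 2) x (eR x)))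
    (fun _ => rfl) (fun _ => rfl) (fun _ => rfl) (fun _ => rfl) (fun _ => rfl)
  obtain ⟨i₁, i₂, i₃, i₄, i₅⟩ := integrable_sliceIntegrands_offAxis hOρ hΦc hΦg hUc hH hΘ hΘc hΘO h1 ht
  exact hmain.trans_eq (intervalIntegral_sliceFunctionals_eq_integral_prod hη h1t i₁ i₂ i₃ i₄ i₅).2

/-! ### The slice integrands across the regular part of the axis -/

/-- **The five slice integrands are space–time integrable for cut-offs meeting the regular axis.**
On a slab `]lo,hi[ × O` (`O` open, possibly meeting the axis) let `Φ` and `∇Φ` be jointly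
continuous on the WHOLE slab, `U` jointly continuous off the axis with `∬_{slab} |U|³ < ∞`,
`H ∈ C²`, `Θ ∈ C¹_c`, `tsupport Θ ⊆ O`, `lo < t₁`, `t < hi`. Then the integrands of `G_H`, `T₁`,
`T_U`, `T_b`, `M` are integrable for `vol|(t₁,t] ⊗ vol` (the drift term by `|U| ≤ 1 + |U|³`, the
axis-drift term `(2/ϱ)H(Φ)∂_ϱΘ²` by `1/ϱ ∈ L¹_loc(ℝ³)`). In particular `s ↦ T_U(s)`, `s ↦ T_b(s)`
are integrable on `[t₁, t]` and all time integrals of Nazarov–Uraltseva's (3.9) are genuine.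
[cite: NazarovUraltseva2012, §3 (3.9) and §4 (4.3), the drift terms] -/
theorem integrable_sliceIntegrands_acrossAxis {O : Set (EuclideanSpace ℝ (Fin 3))} (hO : IsOpen O) {lo hi : ℝ}
    {Φ : ℝ → EuclideanSpace ℝ (Fin 3) → ℝ} {U : ℝ → EuclideanSpace ℝ (Fin 3) → EuclideanSpace ℝ (Fin 3)}
    (hΦc : ContinuousOn (uncurry Φ) (Ioo lo hi ×ˢ O))
    (hΦg : ContinuousOn (fun z : ℝ × EuclideanSpace ℝ (Fin 3) => fderiv ℝ (Φ z.1) z.2) (Ioo lo hi ×ˢ O))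
    (hUc : ContinuousOn (uncurry U) (Ioo lo hi ×ˢ (O ∩ {x | cylRadius x ≠ 0})))
    (hU3 : ∫⁻ z in Ioo lo hi ×ˢ O, ‖U z.1 z.2‖ₑ ^ (3 : ℕ) < ⊤)
    {H : ℝ → ℝ} (hH : ContDiff ℝ 2 H) {Θ : EuclideanSpace ℝ (Fin 3) → ℝ} (hΘ : ContDiff ℝ 1 Θ)
    (hΘc : HasCompactSupport Θ) (hΘO : tsupport Θ ⊆ O) {t₁ t : ℝ} (h1 : lo < t₁) (ht : t < hi) :
    Integrable (fun z : ℝ × EuclideanSpace ℝ (Fin 3) =>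
        deriv (deriv H) (Φ z.1 z.2) * ‖gradient (Φ z.1) z.2‖ ^ 2 * Θ z.2 ^ 2)
        ((volume.restrict (Ioc t₁ t)).prod volume) ∧
      Integrable (fun z : ℝ × EuclideanSpace ℝ (Fin 3) =>
        deriv H (Φ z.1 z.2) * ⟪gradient (Φ z.1) z.2, gradient (fun y => Θ y ^ 2) z.2⟫)
        ((volume.restrict (Ioc t₁ t)).prod volume) ∧
      Integrable (fun z : ℝ × EuclideanSpace ℝ (Fin 3) =>
        H (Φ z.1 z.2) * ⟪U z.1 z.2, gradient (fun y => Θ y ^ 2) z.2⟫)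
        ((volume.restrict (Ioc t₁ t)).prod volume) ∧
      Integrable (fun z : ℝ × EuclideanSpace ℝ (Fin 3) =>
        2 / cylRadius z.2 * (H (Φ z.1 z.2) * fderiv ℝ (fun y => Θ y ^ 2) z.2 (eR z.2)))
        ((volume.restrict (Ioc t₁ t)).prod volume) ∧
      Integrable (fun z : ℝ × EuclideanSpace ℝ (Fin 3) => H (Φ z.1 z.2) * Θ z.2 ^ 2)
        ((volume.restrict (Ioc t₁ t)).prod volume) := by
  set K : Set (EuclideanSpace ℝ (Fin 3)) := tsupport Θ with hKdef
  have hK : IsCompact K := hΘc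
  have hΘ0 : ∀ x, x ∉ K → Θ x = 0 := fun x hx => image_eq_zero_of_notMem_tsupport hx
  have hgΘ0 : ∀ x, x ∉ K → gradient (fun y => Θ y ^ 2) x = 0 := fun x hx => gradient_sq_eq_zero_of_notMem hx
  have hfΘ0 : ∀ x, x ∉ K → fderiv ℝ (fun y => Θ y ^ 2) x = 0 := fun x hx => fderiv_sq_eq_zero_of_notMem hx
  have hH' : ContDiff ℝ 1 (deriv H) := by
    have h2' : ContDiff ℝ (1 + 1) H := by rw [one_add_one_eq_two]; exact hH
    exact h2'.deriv'
  have hΘ2 : ContDiff ℝ 1 fun y => Θ y ^ 2 := hΘ.pow 2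
  have hslab' : Ioo lo hi ×ˢ (O ∩ {x : EuclideanSpace ℝ (Fin 3) | cylRadius x ≠ 0}) ⊆ Ioo lo hi ×ˢ O :=
    prod_mono Subset.rfl inter_subset_left
  have hsubK : Icc t₁ t ×ˢ K ⊆ Ioo lo hi ×ˢ O := prod_mono (fun r hr => ⟨h1.trans_le hr.1, hr.2.trans_lt ht⟩) hΘO
  -- continuity on the slab of the building blocks
  have cHΦ : ContinuousOn (fun z : ℝ × EuclideanSpace ℝ (Fin 3) => H (Φ z.1 z.2)) (Ioo lo hi ×ˢ O) :=
    hH.continuous.comp_continuousOn hΦc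
  have cH'Φ : ContinuousOn (fun z : ℝ × EuclideanSpace ℝ (Fin 3) => deriv H (Φ z.1 z.2)) (Ioo lo hi ×ˢ O) :=
    hH'.continuous.comp_continuousOn hΦc
  have cH''Φ : ContinuousOn (fun z : ℝ × EuclideanSpace ℝ (Fin 3) => deriv (deriv H) (Φ z.1 z.2)) (Ioo lo hi ×ˢ O) :=
    (hH'.continuous_deriv le_rfl).comp_continuousOn hΦc
  have cgΦ : ContinuousOn (fun z : ℝ × EuclideanSpace ℝ (Fin 3) => gradient (Φ z.1) z.2) (Ioo lo hi ×ˢ O) :=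
    (InnerProductSpace.toDual ℝ (EuclideanSpace ℝ (Fin 3))).symm.continuous.comp_continuousOn hΦg
  have cΘ2 : Continuous fun z : ℝ × EuclideanSpace ℝ (Fin 3) => Θ z.2 ^ 2 := (hΘ.continuous.comp continuous_snd).pow 2
  have cgΘ2 : Continuous fun z : ℝ × EuclideanSpace ℝ (Fin 3) => gradient (fun y => Θ y ^ 2) z.2 :=
    (continuous_gradient_of_contDiff hΘ2).comp continuous_snd
  have cfΘ2 : Continuous fun z : ℝ × EuclideanSpace ℝ (Fin 3) => fderiv ℝ (fun y => Θ y ^ 2) z.2 :=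
    (hΘ2.continuous_fderiv one_ne_zero).comp continuous_snd
  have ceR : ContinuousOn (fun z : ℝ × EuclideanSpace ℝ (Fin 3) => eR z.2)
      (Ioo lo hi ×ˢ (O ∩ {x : EuclideanSpace ℝ (Fin 3) | cylRadius x ≠ 0})) :=
    continuousOn_eR_offAxis.comp continuous_snd.continuousOn fun z hz => hz.2.2
  refine ⟨?_, ?_, ?_, ?_, ?_⟩
  · exact integrable_prod_of_continuousOn_of_eq_zero hK hΘO h1 ht ((cH''Φ.mul (cgΦ.norm.pow 2)).mul cΘ2.continuousOn)
      (fun z hz => by simp [hΘ0 z.2 hz])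
  · exact integrable_prod_of_continuousOn_of_eq_zero hK hΘO h1 ht (cH'Φ.mul (cgΦ.inner cgΘ2.continuousOn))
      (fun z hz => by
        show deriv H (Φ z.1 z.2) * ⟪gradient (Φ z.1) z.2, gradient (fun y => Θ y ^ 2) z.2⟫ = 0
        rw [hgΘ0 z.2 hz, inner_zero_right, mul_zero])
  · exact integrable_prod_driftTerm hO hK hΘO h1 ht hUc hU3 cHΦ cgΘ2.continuousOn (fun z hz => hgΘ0 z.2 hz)
  · -- the axis-drift term: `w = H(Φ) ∂_ϱΘ²` is continuous off the axis and bounded on `[t₁,t] × K`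
    obtain ⟨CH, hCH⟩ := (isCompact_Icc.prod hK).exists_bound_of_continuousOn (cHΦ.mono hsubK)
    obtain ⟨CΘ, hCΘ⟩ := (isCompact_Icc.prod hK).exists_bound_of_continuousOn (cfΘ2.continuousOn (s := Icc t₁ t ×ˢ K))
    refine integrable_prod_axisDriftTerm hO hK hΘO h1 ht ((cHΦ.mono hslab').mul (cfΘ2.continuousOn.clm_apply ceR))
      (fun z hz => by simp [hfΘ0 z.2 hz]) (C := CH * CΘ) fun z hz => ?_
    rw [abs_mul]
    refine mul_le_mul (by simpa [Real.norm_eq_abs] using hCH z hz) ?_ (abs_nonneg _) ((norm_nonneg _).trans (hCH z hz))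
    calc |fderiv ℝ (fun y => Θ y ^ 2) z.2 (eR z.2)| ≤ ‖fderiv ℝ (fun y => Θ y ^ 2) z.2‖ * ‖eR z.2‖ := by
          rw [← Real.norm_eq_abs]; exact ContinuousLinearMap.le_opNorm _ _
      _ ≤ CΘ * 1 := mul_le_mul (hCΘ z hz) (norm_eR_le_one _) (norm_nonneg _) ((norm_nonneg _).trans (hCΘ z hz))
      _ = CΘ := mul_one _
  · exact integrable_prod_of_continuousOn_of_eq_zero hK hΘO h1 ht (cHΦ.mul cΘ2.continuousOn)
      (fun z hz => by simp [hΘ0 z.2 hz])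

end Summit.NavierStokesRegularity.NavierStokesRegularity.Theorems.AxisymmetricKatoGlobal.EulerScaling

end
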